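import Summits.QuantumFields.BalabanUV.Beta.FP.TowerLawFullIndex
import Summits.QuantumFields.BalabanUV.Beta.FP.PackedLegOneShotSockets

/-!
# `BalabanUV.Beta.FP.TowerLawFullIndexCharts` — road «FP» for binder row D1, ROUTE T, SPEC #41∕#42 (3): **#41d `TowerLawFullIndex` WITH THE EIGHT (S3-1)
# ONE-SHOT SOCKETS DISCHARGED BY leaf-05 `PackedLegOneShotSockets`** — the «#41d′-after-(C1)» shape (the OWNER d1-p3 g27 W-FP-27-4: «AFTER (C1) the
# successor's #41d′ is exactly [leaf-05's] PROBE J7 body»): per one-shot system N ∕ F the binders `hX_X hEA_X hAE_X hL_X` (2 × 4, with their index data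
# 2 × 7) are REPLACED by the composite one-shot CHART `(A_X, 𝕄_X)` (an2's (C1); of record: K-U3d's lattice pair `(Ψ̂∘coDressKBmAt∘Ψ̂ᵀ, bhKcomp)`,
# an2 g48 W-an2-g48-3) through its SEVEN LETTERS, the slot presentation and TWO BLOCK IDENTIFICATIONS `hH_X hQ_X` — all DISPLAYED; the idle abbreviation
# `P` of #41d is dropped (`hP := rfl`), `τ₁` is kept (it names `Γ I L S`'s system) and substituted

WHAT.  `hessT_fullIndex_law_tower_of_charts`: #41d's binders VERBATIM except as said ⊢ #41d's conclusion `hessT (perF T A_N) V_N V′_N W_N = hessT (perF T A_F)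
V_F V′_F W_F + hessT (perF M′ (Π̂ᵀ(KInvStep Lc (lev 0))Π̂ @ rs 0)) V_G V′_G W_G`; proof = ONE term: #41d `hessT_fullIndex_law_tower` at `hXN ∕ hEAN ∕ hAEN ∕ hLN :=
towerN_rightInverse ∕ (towerN_rules).1 ∕ .2 ∕ towerN_leg` and `hXF ∕ hEAF ∕ hAEF ∕ hLF := towerF_rightInverse ∕ (towerF_rules).1 ∕ .2 ∕ towerF_leg`, `ρN := bigRoot Lc rs (n+1)`,
`LNc := bigRatio Lc (n+1)`, `ρF := bigRoot Lc (rs ∘ succ) n`, `LFc := bigRatio Lc n`.  [folklore] composition BY NAME; no `def`, no `def … : Prop`, nothing cited,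
0 sorry; 0 estimates.  The chart letters, block identifications, rows and namings are HYPOTHESES (nothing of the dictionary ∕ Bałaban's asserted).  NOT HERE:
(C1) itself (the letters + block identifications of K-U3d's pair — an2), the (S3-2) namings, de-periodisation ((P2‴)), (L2′), the END (#28 §4).

HONEST DEPENDENCY (page 1, mandatory): continuum YM on T⁴ ⇐ BetaPertH ∧ nine spine estimates (0/9 proved); BetaPertH ⇐ (D1) ∧ (D4) ∧ CAP+tail;
G-an2-4 gates asym, D1 and NE2/3/4.  HONEST FRAMING (cell contract, verbatim): «discharging `BetaPertH` makes Bałaban's UV stability UNCONDITIONAL —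
a real constructive-QFT result; it is NOT the continuum limit and NOT the Clay problem.»  ABSOLUTE RULE (cell charter, verbatim): «No internally-minted
statement may enter as a cited fact. Every hypothesis is either kernel-proved in this package or a verbatim quotation of a PUBLISHED theorem with page
reference. The manuscript(s) under audit are NOT citable for their own disputed steps — they are the thing under adjudication; programme-internal
(2001/route/tribunal) claims are never citable.»  0∕4 row-D1 binders (hW, hR, D1Tel, D1Rep — `D1Tel` CONCLUDED only from displayed rows); NOT (T-ID), NOT SDF,
NOT D1, NOT BetaPertH, NOT continuum, NOT Clay.  D1 formalisation swarm, unit `b2b-balaban-beta-d1-formalise-leaf-05` gen 37, 2026-08-23, on the road «FP»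
OWNER's word W-FP-27-4 (statement generated from #41d's text by script; OFFERED to the OWNER — his to file or to regenerate).  No existing file touched.
-/

noncomputable section

open scoped BigOperators Matrix

namespace Summit.QuantumFields.BalabanUV.Beta.FP.TowerLawFullIndexCharts


open Matrix Finset
open Literature.Probability.LatticeModels (Torus.proj)
open Literature.MathematicalPhysics.QuantumFieldTheory.Balaban1983to89
open Literature.MathematicalPhysics.QuantumFieldTheory.Balaban1983to89.Beta
open Literature.MathematicalPhysics.QuantumFieldTheory.Balaban1983to89.Beta.Composition (kkt)
open Literature.MathematicalPhysics.QuantumFieldTheory.Balaban1983to89.Beta.CompositionSingular (effForm flucCov minOp minOpL)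
open B5Prop11Plancherel (fine)
open B6Lemma24Torus (pbox mem_pbox)
open AffineAveraging (Site box toSite unitVec)
open OneStepResolventKernel (Fib)
open OneStepKernelFamily (KInvStep)
open ExpKernelCalculus (MKer)
open BalabanStepJetsSucc (wVH)
open Summit.QuantumFields.BalabanUV.Beta.AxialDressingRooted (axEc coDressKBmAt)
open Summit.QuantumFields.BalabanUV.Beta.BorderedHessian (bhKStepAt stepScale)
open Summit.QuantumFields.BalabanUV.Beta.D1BFx.LogDetSecondVariation (secondVar)
open Summit.QuantumFields.BalabanUV.Beta.D1BFx.MixedVarPackedHess (hessT)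
open Summit.QuantumFields.BalabanUV.Beta.FP.KernelPeriodisationFib (Idx perF)
open Summit.QuantumFields.BalabanUV.Beta.FP.TorusCombRows (Res combRowsT)
open Summit.QuantumFields.BalabanUV.Beta.FP.TorusCompositeObjects (towerTorus compRows NParam combF bigP towerGen)
open Summit.QuantumFields.BalabanUV.Beta.FP.TorusCompositeFP (evalN)
open Summit.QuantumFields.BalabanUV.Beta.FP.TorusGaugeCovariance (tgrad)
open Summit.QuantumFields.BalabanUV.Beta.GAN24.FineReadoutCauchyFrame (toSite_mem_range)
open Summit.QuantumFields.BalabanUV.Beta.FP.RelInvPeriodisedEffFormCoarse (wVH_pos)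
open Summit.QuantumFields.BalabanUV.Beta.FP.KktUnitConjugation (kkt_inv_smul_mul_rightInverse fromBlocks_one_units_eq_diagonal fromBlocks_units_one_eq_diagonal
  submatrix_diagonal_mul_mul_diagonal sumElim_const_comp_map hessT_unitConj)
open Summit.QuantumFields.BalabanUV.Beta.FP.PackedLegCombRooted (packedLeg_combAt_eq kkt_mul_inv_combAt perF_rules_combAt)
open Summit.QuantumFields.BalabanUV.Beta.FP.PackedLawFullIndex (hessT_fullIndex_law_of_packed_law)
open Summit.QuantumFields.BalabanUV.Beta.FP.NestedDeadRowsOrderTwoTowerClosed (torus_kkt_nondeg_tower)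
open Summit.QuantumFields.BalabanUV.Beta.FP.NestedDoorSocketTower (hessT_kernel_law_tower)

open ExpKernelCalculus (shiftK)
open Summit.QuantumFields.BalabanUV.Beta.TameKernelCalculus (Spr)
open Summit.QuantumFields.BalabanUV.Beta.ChartConjugationRelative (RelInv)
open Summit.QuantumFields.BalabanUV.Beta.FP.TorusCompositeObjects (bigRatio bigRoot)
open Summit.QuantumFields.BalabanUV.Beta.FP.TowerLawFullIndex (hessT_fullIndex_law_tower)
open Summit.QuantumFields.BalabanUV.Beta.FP.PackedLegOneShotSockets (towerN_rules towerN_rightInverse towerN_leg towerF_rules towerF_rightInverse towerF_leg)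

variable {d : ℕ}

section Law

variable (M' : Fin (d + 1) → ℕ) [∀ μ, NeZero (M' μ)] (Lc : ℕ) [NeZero Lc] (lev : ℕ → ℕ) (rs : ℕ → (Fin (d + 1) → ℕ)) (n : ℕ)

set_option synthInstance.maxSize 1024 in
set_option maxHeartbeats 1600000 in
/-- [folklore] **THE TOWER's (T-ID) LAW ON THE FIBRED TORUS INDICES, THE ONE-SHOT LEGS READ FROM THE COMPOSITE CHARTS** (#41d′): #41d
`hessT_fullIndex_law_tower`'s binders VERBATIM except that, per one-shot system, the right inverse ∕ torus rules ∕ leg (`hX hEA hAE hL`) are REPLACED by the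
chart `(A_X, 𝕄_X)`'s seven letters, the slot presentation and the two block identifications (DISPLAYED — (C1)), and the idle abbreviation `P` is dropped;
same conclusion.  Proof: #41d at the eight sockets of leaf-05 `PackedLegOneShotSockets` (ONE term). -/
theorem hessT_fullIndex_law_tower_of_charts (hrs : ∀ k, rs k ∈ box (d + 1) Lc) (hlev : ∀ i, lev i = lev (i + 1) + 1)
    (hM' : ∀ i, Lc ∣ M' i)
    -- the top multipliers' slot presentation (#21 VERBATIM)
    {κ : Type*} [Fintype κ] [DecidableEq κ] (pμ' : κ → ↥(pbox M')) (mμ' : κ → Fin (d + 1))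
    (hfμ' : Function.Injective (fun a : κ => ((pμ' a, Sum.inr (mμ' a)) : Idx M' (Fib d))))
    (hcoarse' : ∀ (s : ↥(pbox M')) (m : Fin (d + 1)),
      ((s, Sum.inr m) : Idx M' (Fib d)) ∈ Set.range (fun a : κ => ((pμ' a, Sum.inr (mμ' a)) : Idx M' (Fib d))) ↔ Torus.proj Lc (s : Site (d + 1)) = 0)
    -- the composite objects of record, PINNED (#21 VERBATIM)
    {H₀ : Matrix (↥(pbox (towerTorus Lc M' (n + 1))) × Fin (d + 1)) (↥(pbox (towerTorus Lc M' (n + 1))) × Fin (d + 1)) ℝ}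
    {Q₁₀ : Matrix (↥(pbox M') × Fin (d + 1)) (↥(pbox (towerTorus Lc M' (n + 1))) × Fin (d + 1)) ℝ}
    {τ₁ : Matrix (NParam Lc (fine Lc M') (fun k => rs (k + 1)) n) (↥(pbox (towerTorus Lc M' (n + 1))) × Fin (d + 1)) ℝ}
    (hH₀ : H₀ = (perF (towerTorus Lc M' (n + 1)) (bhKStepAt d (toSite (rs (n + 1))) Lc (lev (n + 1)))).submatrix
        (fun b : (↥(pbox (towerTorus Lc M' (n + 1))) × Fin (d + 1)) => ((b.1, Sum.inl b.2) : Idx (towerTorus Lc M' (n + 1)) (Fib d)))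
        (fun b : (↥(pbox (towerTorus Lc M' (n + 1))) × Fin (d + 1)) => ((b.1, Sum.inl b.2) : Idx (towerTorus Lc M' (n + 1)) (Fib d))))
    (hQ₁₀ : Q₁₀ = compRows Lc M' lev rs (n + 1))
    (hτ₁ : τ₁ = bigP Lc (fine Lc M') (fun k => rs (k + 1)) (fun k => toSite_mem_range (hrs (k + 1))) n)
    {τ₂ : Matrix (Res (toSite (rs 0)) Lc M') (↥(pbox M') × Fin (d + 1)) ℝ} (hτ₂ : τ₂ = combF Lc M' (rs 0))
    {Q₂₀ : Matrix κ (↥(pbox M') × Fin (d + 1)) ℝ}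
    (hQ₂₀ : Q₂₀ = (perF M' (bhKStepAt d (toSite (rs 0)) Lc (lev 0))).submatrix (fun a : κ => ((pμ' a, Sum.inr (mμ' a)) : Idx M' (Fib d)))
        (fun b : (↥(pbox M') × Fin (d + 1)) => ((b.1, Sum.inl b.2) : Idx M' (Fib d))))
    {W₀ : Matrix (↥(pbox (towerTorus Lc M' (n + 1))) × Fin (d + 1)) (NParam Lc M' rs (n + 1)) ℝ} (hW₀ : W₀ = towerGen Lc M' rs (n + 1))
    -- the step constant of the chart transport (#21's `c`), the (COV-m) order-0 image PINNED, the one-shot resolvent words and `𝔔₀` NAMED (#21 VERBATIM)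
    (c : ℝ)
    {Dbar : Matrix (↥(pbox M') × Fin (d + 1)) (Res (toSite (rs 0)) Lc M') ℝ}
    (hDbar : Dbar = (∏ i ∈ range (n + 1), (stepScale d Lc (lev (i + 1)) * ((box (d + 1) Lc).card : ℝ))) •
        (tgrad M').submatrix (fun a : (↥(pbox M') × Fin (d + 1)) => ((a.1, Sum.inl a.2) : Idx M' (Fib d))) (fun t : (Res (toSite (rs 0)) Lc M') => (t.1 : ↥(pbox M'))))
    {Γ : Matrix (↥(pbox (towerTorus Lc M' (n + 1))) × Fin (d + 1)) (↥(pbox (towerTorus Lc M' (n + 1))) × Fin (d + 1)) ℝ} {I : Matrix (↥(pbox (towerTorus Lc M' (n + 1))) × Fin (d + 1)) ((↥(pbox M') × Fin (d + 1)) ⊕ (NParam Lc (fine Lc M') (fun k => rs (k + 1)) n)) ℝ} {L : Matrix ((↥(pbox M') × Fin (d + 1)) ⊕ (NParam Lc (fine Lc M') (fun k => rs (k + 1)) n)) (↥(pbox (towerTorus Lc M' (n + 1))) × Fin (d + 1)) ℝ} {S : Matrix ((↥(pbox M') × Fin (d + 1)) ⊕ (NParam Lc (fine Lc M') (fun k =>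 rs (k + 1)) n)) ((↥(pbox M') × Fin (d + 1)) ⊕ (NParam Lc (fine Lc M') (fun k => rs (k + 1)) n)) ℝ}
    (hΓ : flucCov H₀ (fromRows Q₁₀ τ₁) = Γ) (hI : minOp H₀ (fromRows Q₁₀ τ₁) = I) (hL : minOpL H₀ (fromRows Q₁₀ τ₁) = L) (hS : effForm H₀ (fromRows Q₁₀ τ₁) = S)
    {𝔔₀ : Matrix κ (↥(pbox (towerTorus Lc M' (n + 1))) × Fin (d + 1)) ℝ} (h𝔔₀ : Q₂₀ * Q₁₀ = 𝔔₀)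
    -- the direction module and its DISPLAYED read-outs: finest-level direction `h := hv v` (enters only the rows and the generator jets — no linearity
    -- needed here: the jets' (bi)linearity is displayed; at the record it follows from `hv`'s), tree-gauge parameter `λ := lv v` and top generator
    -- `X̄ := Xbf v` (LINEAR: they enter the one-shot namings `k1 k2 q1 q2`)
    {V : Type*} [AddCommGroup V] [Module ℝ V]
    (hv : V → ((↥(pbox (towerTorus Lc M' (n + 1))) × Fin (d + 1)) → ℝ)) (lv : V → (↥(pbox (towerTorus Lc M' (n + 1))) → ℝ))
    (hlv : ∀ (r : ℝ) (x y : V), lv (r • x + y) = r • lv x + lv y)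
    (Xbf : V → Matrix κ κ ℝ) (hXbf : ∀ (r : ℝ) (x y : V), Xbf (r • x + y) = r • Xbf x + Xbf y)
    -- #21's displayed jets AS FUNCTIONS of the direction: first order linear, second order in two slots (linear in each; the door reads the diagonal)
    (H₁f : V → Matrix (↥(pbox (towerTorus Lc M' (n + 1))) × Fin (d + 1)) (↥(pbox (towerTorus Lc M' (n + 1))) × Fin (d + 1)) ℝ) (hH₁l : ∀ (r : ℝ) (x y : V), H₁f (r • x + y) = r • H₁f x + H₁f y)
    (Q₁₁f : V → Matrix (↥(pbox M') × Fin (d + 1)) (↥(pbox (towerTorus Lc M' (n + 1))) × Fin (d + 1)) ℝ) (hQ₁₁l : ∀ (r : ℝ) (x y : V), Q₁₁f (r • x + y) = r • Q₁₁f x + Q₁₁f y)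
    (Q₂₁f : V → Matrix κ (↥(pbox M') × Fin (d + 1)) ℝ) (hQ₂₁l : ∀ (r : ℝ) (x y : V), Q₂₁f (r • x + y) = r • Q₂₁f x + Q₂₁f y)
    (H₂f : V → V → Matrix (↥(pbox (towerTorus Lc M' (n + 1))) × Fin (d + 1)) (↥(pbox (towerTorus Lc M' (n + 1))) × Fin (d + 1)) ℝ)
    (hH₂l : ∀ (r : ℝ) (x y z : V), H₂f (r • x + y) z = r • H₂f x z + H₂f y z) (hH₂r : ∀ (r : ℝ) (x y z : V), H₂f z (r • x + y) = r • H₂f z x + H₂f z y)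
    (Q₁₂f : V → V → Matrix (↥(pbox M') × Fin (d + 1)) (↥(pbox (towerTorus Lc M' (n + 1))) × Fin (d + 1)) ℝ)
    (hQ₁₂l : ∀ (r : ℝ) (x y z : V), Q₁₂f (r • x + y) z = r • Q₁₂f x z + Q₁₂f y z) (hQ₁₂r : ∀ (r : ℝ) (x y z : V), Q₁₂f z (r • x + y) = r • Q₁₂f z x + Q₁₂f z y)
    (Q₂₂f : V → V → Matrix κ (↥(pbox M') × Fin (d + 1)) ℝ)
    (hQ₂₂l : ∀ (r : ℝ) (x y z : V), Q₂₂f (r • x + y) z = r • Q₂₂f x z + Q₂₂f y z) (hQ₂₂r : ∀ (r : ℝ) (x y z : V), Q₂₂f z (r • x + y) = r • Q₂₂f z x + Q₂₂f z y)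
    -- #21's composite and one-shot NAMINGS as functions (`h𝔔₁ h𝔔₂ k1 k2 q1 q2`; `X := −(c • diagonal (λ ∘ pr))` at `λ := lv v`; order 2 in two slots)
    (𝔔₁f : V → Matrix κ (↥(pbox (towerTorus Lc M' (n + 1))) × Fin (d + 1)) ℝ) (h𝔔₁ : ∀ v, Q₂₁f v * Q₁₀ + Q₂₀ * Q₁₁f v = 𝔔₁f v)
    (𝔔₂f : V → V → Matrix κ (↥(pbox (towerTorus Lc M' (n + 1))) × Fin (d + 1)) ℝ)
    (h𝔔₂ : ∀ v v', Q₂₂f v v' * Q₁₀ + Q₂₁f v * Q₁₁f v' + (Q₂₁f v * Q₁₁f v' + Q₂₀ * Q₁₂f v v') = 𝔔₂f v v')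
    (H'₁f : V → Matrix (↥(pbox (towerTorus Lc M' (n + 1))) × Fin (d + 1)) (↥(pbox (towerTorus Lc M' (n + 1))) × Fin (d + 1)) ℝ)
    (hH'₁f : ∀ v, H'₁f v = -((-(c • Matrix.diagonal (fun b : (↥(pbox (towerTorus Lc M' (n + 1))) × Fin (d + 1)) => lv v b.1)))ᵀ * H₀) + H₁f v + H₀ * (-(c • Matrix.diagonal (fun b : (↥(pbox (towerTorus Lc M' (n + 1))) × Fin (d + 1)) => lv v b.1))))
    (H'₂f : V → V → Matrix (↥(pbox (towerTorus Lc M' (n + 1))) × Fin (d + 1)) (↥(pbox (towerTorus Lc M' (n + 1))) × Fin (d + 1)) ℝ)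
    (hH'₂f : ∀ v v', H'₂f v v' = ((-(c • Matrix.diagonal (fun b : (↥(pbox (towerTorus Lc M' (n + 1))) × Fin (d + 1)) => lv v b.1))) * (-(c • Matrix.diagonal (fun b : (↥(pbox (towerTorus Lc M' (n + 1))) × Fin (d + 1)) => lv v' b.1))))ᵀ * H₀ + (-((-(c • Matrix.diagonal (fun b : (↥(pbox (towerTorus Lc M' (n + 1))) × Fin (d + 1)) => lv v b.1)))ᵀ * H₁f v') + -((-(c • Matrix.diagonal (fun b : (↥(pbox (towerTorus Lc M' (n + 1))) × Fin (d + 1)) => lv v b.1)))ᵀ * H₀ * (-(c • Matrix.diagonal (fun b : (↥(pbox (towerTorus Lc M' (n + 1))) × Fin (d + 1)) => lv v' b.1)))))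
      + ((-((-(c • Matrix.diagonal (fun b : (↥(pbox (towerTorus Lc M' (n + 1))) × Fin (d + 1)) => lv v b.1)))ᵀ * H₁f v') + -((-(c • Matrix.diagonal (fun b : (↥(pbox (towerTorus Lc M' (n + 1))) × Fin (d + 1)) => lv v b.1)))ᵀ * H₀ * (-(c • Matrix.diagonal (fun b : (↥(pbox (towerTorus Lc M' (n + 1))) × Fin (d + 1)) => lv v' b.1))))) + (H₂f v v' + H₁f v * (-(c • Matrix.diagonal (fun b : (↥(pbox (towerTorus Lc M' (n + 1))) × Fin (d + 1)) => lv v' b.1))) + (H₁f v * (-(c • Matrix.diagonal (fun b : (↥(pbox (towerTorus Lc M' (n + 1))) × Fin (d + 1)) => lv v' b.1))) + H₀ * ((-(c • Matrix.diagonal (fun b : (↥(pbox (towerTorus Lc M' (n + 1))) × Fin (d + 1)) => lv v b.1))) * (-(c • Matrix.diagonal (fun b : (↥(pbox (towerTorus Lc M' (n + 1))) × Fin (d + 1)) => lv v' b.1))))))))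
    (𝔔'₁f : V → Matrix κ (↥(pbox (towerTorus Lc M' (n + 1))) × Fin (d + 1)) ℝ) (h𝔔'₁f : ∀ v, 𝔔'₁f v = Xbf v * 𝔔₀ + 𝔔₁f v + 𝔔₀ * (-(c • Matrix.diagonal (fun b : (↥(pbox (towerTorus Lc M' (n + 1))) × Fin (d + 1)) => lv v b.1))))
    (𝔔'₂f : V → V → Matrix κ (↥(pbox (towerTorus Lc M' (n + 1))) × Fin (d + 1)) ℝ)
    (h𝔔'₂f : ∀ v v', 𝔔'₂f v v' = Xbf v * Xbf v' * 𝔔₀ + (Xbf v * 𝔔₁f v' + Xbf v * 𝔔₀ * (-(c • Matrix.diagonal (fun b : (↥(pbox (towerTorus Lc M' (n + 1))) × Fin (d + 1)) => lv v' b.1))))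
      + ((Xbf v * 𝔔₁f v' + Xbf v * 𝔔₀ * (-(c • Matrix.diagonal (fun b : (↥(pbox (towerTorus Lc M' (n + 1))) × Fin (d + 1)) => lv v' b.1)))) + (𝔔₂f v v' + 𝔔₁f v * (-(c • Matrix.diagonal (fun b : (↥(pbox (towerTorus Lc M' (n + 1))) × Fin (d + 1)) => lv v' b.1))) + (𝔔₁f v * (-(c • Matrix.diagonal (fun b : (↥(pbox (towerTorus Lc M' (n + 1))) × Fin (d + 1)) => lv v' b.1))) + 𝔔₀ * ((-(c • Matrix.diagonal (fun b : (↥(pbox (towerTorus Lc M' (n + 1))) × Fin (d + 1)) => lv v b.1))) * (-(c • Matrix.diagonal (fun b : (↥(pbox (towerTorus Lc M' (n + 1))) × Fin (d + 1)) => lv v' b.1))))))))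
    -- #21's generator jets by their closed forms at `h := hv v` (weight `h`), per direction
    (W₁f W₂f : V → Matrix (↥(pbox (towerTorus Lc M' (n + 1))) × Fin (d + 1)) (NParam Lc M' rs (n + 1)) ℝ)
    (hW₁f : ∀ v, W₁f v = Matrix.of fun (b : (↥(pbox (towerTorus Lc M' (n + 1))) × Fin (d + 1))) (e : (NParam Lc M' rs (n + 1))) => -(c * hv v b * evalN Lc M' rs (n + 1) (fun b' : (↥(pbox (towerTorus Lc M' (n + 1))) × Fin (d + 1)) => (b'.1 : Site (d + 1)) + unitVec b'.2) b e))
    (hW₂f : ∀ v, W₂f v = Matrix.of fun (b : (↥(pbox (towerTorus Lc M' (n + 1))) × Fin (d + 1))) (e : (NParam Lc M' rs (n + 1))) => (c * hv v b) ^ 2 * evalN Lc M' rs (n + 1) (fun b' : (↥(pbox (towerTorus Lc M' (n + 1))) × Fin (d + 1)) => (b'.1 : Site (d + 1)) + unitVec b'.2) b e)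
    -- the (COV-m) order-1∕2 images and the (WARD-m) sources, per direction (free)
    (Db₁f Db₂f : V → Matrix (↥(pbox M') × Fin (d + 1)) (Res (toSite (rs 0)) Lc M') ℝ) (Y₁f Y₂f : V → Matrix κ (NParam Lc M' rs (n + 1)) ℝ)
    -- the `G`-side DRESSED WORDS, NAMED (#36b's shapes at `B := [Q₁₁f v; 0]`)
    (Gw₁f : V → Matrix (↥(pbox M') × Fin (d + 1)) (↥(pbox M') × Fin (d + 1)) ℝ)
    (hGw₁f : ∀ v, Gw₁f v = ((L * (H₁f v) - S * (fromRows (Q₁₁f v) (0 : Matrix (NParam Lc (fine Lc M') (fun k => rs (k + 1)) n) (↥(pbox (towerTorus Lc M' (n + 1))) × Fin (d + 1)) ℝ))) * I + L * (fromRows (Q₁₁f v) (0 : Matrix (NParam Lc (fine Lc M') (fun k => rs (k + 1)) n) (↥(pbox (towerTorus Lc M' (n + 1))) × Fin (d + 1)) ℝ))ᵀ * S).toBlocks₁₁)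
    (Gw₂f : V → V → Matrix (↥(pbox M') × Fin (d + 1)) (↥(pbox M') × Fin (d + 1)) ℝ)
    (hGw₂f : ∀ v v', Gw₂f v v' =
      ((((-((L * (H₁f v) - S * (fromRows (Q₁₁f v) (0 : Matrix (NParam Lc (fine Lc M') (fun k => rs (k + 1)) n) (↥(pbox (towerTorus Lc M' (n + 1))) × Fin (d + 1)) ℝ))) * Γ - L * (fromRows (Q₁₁f v) (0 : Matrix (NParam Lc (fine Lc M') (fun k => rs (k + 1)) n) (↥(pbox (towerTorus Lc M' (n + 1))) × Fin (d + 1)) ℝ))ᵀ * L) * (H₁f v') + L * (H₂f v v')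
          - (((L * (H₁f v) - S * (fromRows (Q₁₁f v) (0 : Matrix (NParam Lc (fine Lc M') (fun k => rs (k + 1)) n) (↥(pbox (towerTorus Lc M' (n + 1))) × Fin (d + 1)) ℝ))) * I + L * (fromRows (Q₁₁f v) (0 : Matrix (NParam Lc (fine Lc M') (fun k => rs (k + 1)) n) (↥(pbox (towerTorus Lc M' (n + 1))) × Fin (d + 1)) ℝ))ᵀ * S) * (fromRows (Q₁₁f v') (0 : Matrix (NParam Lc (fine Lc M') (fun k => rs (k + 1)) n) (↥(pbox (towerTorus Lc M' (n + 1))) × Fin (d + 1)) ℝ)) + S * (fromRows (Q₁₂f v v') (0 : Matrix (NParam Lc (fine Lc M') (fun k => rs (k + 1)) n) (↥(pbox (towerTorus Lc M' (n + 1))) × Fin (d + 1)) ℝ)))) * I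
        + (L * (H₁f v) - S * (fromRows (Q₁₁f v) (0 : Matrix (NParam Lc (fine Lc M') (fun k => rs (k + 1)) n) (↥(pbox (towerTorus Lc M' (n + 1))) × Fin (d + 1)) ℝ))) * (-((Γ * (H₁f v') + I * (fromRows (Q₁₁f v') (0 : Matrix (NParam Lc (fine Lc M') (fun k => rs (k + 1)) n) (↥(pbox (towerTorus Lc M' (n + 1))) × Fin (d + 1)) ℝ))) * I + Γ * (fromRows (Q₁₁f v') (0 : Matrix (NParam Lc (fine Lc M') (fun k => rs (k + 1)) n) (↥(pbox (towerTorus Lc M' (n + 1))) × Fin (d + 1)) ℝ))ᵀ * S)))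
      - ((-((L * (H₁f v) - S * (fromRows (Q₁₁f v) (0 : Matrix (NParam Lc (fine Lc M') (fun k => rs (k + 1)) n) (↥(pbox (towerTorus Lc M' (n + 1))) × Fin (d + 1)) ℝ))) * Γ - L * (fromRows (Q₁₁f v) (0 : Matrix (NParam Lc (fine Lc M') (fun k => rs (k + 1)) n) (↥(pbox (towerTorus Lc M' (n + 1))) × Fin (d + 1)) ℝ))ᵀ * L) * (-(fromRows (Q₁₁f v') (0 : Matrix (NParam Lc (fine Lc M') (fun k => rs (k + 1)) n) (↥(pbox (towerTorus Lc M' (n + 1))) × Fin (d + 1)) ℝ))ᵀ) + L * (fromRows (Q₁₂f v v') (0 : Matrix (NParam Lc (fine Lc M') (fun k => rs (k + 1)) n) (↥(pbox (towerTorus Lc M' (n + 1))) × Fin (d + 1)) ℝ))ᵀ) * S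
          + L * (-(fromRows (Q₁₁f v) (0 : Matrix (NParam Lc (fine Lc M') (fun k => rs (k + 1)) n) (↥(pbox (towerTorus Lc M' (n + 1))) × Fin (d + 1)) ℝ))ᵀ) * ((L * (H₁f v') - S * (fromRows (Q₁₁f v') (0 : Matrix (NParam Lc (fine Lc M') (fun k => rs (k + 1)) n) (↥(pbox (towerTorus Lc M' (n + 1))) × Fin (d + 1)) ℝ))) * I + L * (fromRows (Q₁₁f v') (0 : Matrix (NParam Lc (fine Lc M') (fun k => rs (k + 1)) n) (↥(pbox (towerTorus Lc M' (n + 1))) × Fin (d + 1)) ℝ))ᵀ * S)))).toBlocks₁₁)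
    -- #21's ROWS, FOR EVERY DIRECTION: the coarse chart's Faddeev–Popov 2-jet, the form parities, the graded Ward rows, (COV-m) orders 1, 2 on both levels
    (uTop : ∀ v, secondVar (τ₂ * Dbar) (τ₂ * Db₁f v) (τ₂ * Db₂f v) = 0)
    (hH₁t : ∀ v, (H₁f v)ᵀ = -H₁f v) (hH₂t : ∀ v, (H₂f v v)ᵀ = H₂f v v)
    (a1 : ∀ v, H₁f v * W₀ + H₀ * W₁f v = 𝔔₀ᵀ * Y₁f v)
    (a2 : ∀ v, H₂f v v * W₀ + (2 : ℝ) • (H₁f v * W₁f v) + H₀ * W₂f v = -((2 : ℝ) • ((𝔔₁f v)ᵀ * Y₁f v)) + 𝔔₀ᵀ * Y₂f v)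
    (c1 : ∀ v, Q₁₁f v * W₀ + Q₁₀ * W₁f v = fromCols (Db₁f v) (0 : Matrix (↥(pbox M') × Fin (d + 1)) (NParam Lc (fine Lc M') (fun k => rs (k + 1)) n) ℝ))
    (c2 : ∀ v, Q₁₂f v v * W₀ + (2 : ℝ) • (Q₁₁f v * W₁f v) + Q₁₀ * W₂f v = fromCols (Db₂f v) (0 : Matrix (↥(pbox M') × Fin (d + 1)) (NParam Lc (fine Lc M') (fun k => rs (k + 1)) n) ℝ))
    (d1 : ∀ v, Q₂₁f v * Dbar + Q₂₀ * Db₁f v = 0) (d2 : ∀ v, Q₂₂f v v * Dbar + (2 : ℝ) • (Q₂₁f v * Db₁f v) + Q₂₀ * Db₂f v = 0)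
    -- a finite family of directions, a pair
    {σ : Type*} [Fintype σ] [DecidableEq σ] (dv : σ → V) (k l : σ)
    -- (S3-1) N — the composite ONE-SHOT CHART `(A_N, 𝕄_N)` of depth `n+2` (an2's (C1); of record: K-U3d's lattice pair) by its SEVEN LETTERS at scale
    -- `bigRatio Lc (n+1)`, root `bigRoot Lc rs (n+1)`, the slot presentation `fN`, and the TWO BLOCK IDENTIFICATIONS `hHN hQN` — DISPLAYED ((C1) discharges them);
    -- the four sockets `hXN hEAN hAEN hLN` of #41d come from leaf-05 `PackedLegOneShotSockets.towerN_rightInverse ∕ towerN_rules ∕ towerN_leg`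
    {AN MhN : MKer (d + 1) (Fib d)} (hAN : Spr AN) (hMhN : Spr MhN)
    (hANt : ∀ t : Fin (d + 1) → ℤ, shiftK ((bigRatio Lc (n + 1) : ℤ) • t) AN = AN) (hMhNt : ∀ t : Fin (d + 1) → ℤ, shiftK ((bigRatio Lc (n + 1) : ℤ) • t) MhN = MhN)
    (hrelN : RelInv AN MhN (axEc (bigRoot Lc rs (n + 1)) (bigRatio Lc (n + 1))))
    (hmmN : ∀ (x y : Fin (d + 1) → ℤ) (κ' l' : Fin (d + 1)), MhN x y (Sum.inr κ') (Sum.inr l') = 0)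
    (hantiN : ∀ (x y : Fin (d + 1) → ℤ) (κ' l' : Fin (d + 1)), MhN x y (Sum.inl κ') (Sum.inr l') = -MhN y x (Sum.inr l') (Sum.inl κ'))
    (fN : κ → Idx (towerTorus Lc M' (n + 1)) (Fib d)) (hfN : Function.Injective fN)
    (hmN : ∀ a : κ, ∃ m : Fin (d + 1), (fN a).2 = Sum.inr m)
    (hcN : ∀ (s : ↥(pbox (towerTorus Lc M' (n + 1)))) (m : Fin (d + 1)), ((s, Sum.inr m) : Idx (towerTorus Lc M' (n + 1)) (Fib d)) ∈ Set.range fN ↔ Torus.proj (bigRatio Lc (n + 1)) (s : Site (d + 1)) = 0)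
    (hHN : (perF (towerTorus Lc M' (n + 1)) MhN).submatrix (fun b : ↥(pbox (towerTorus Lc M' (n + 1))) × Fin (d + 1) => ((b.1, Sum.inl b.2) : Idx (towerTorus Lc M' (n + 1)) (Fib d))) (fun b : ↥(pbox (towerTorus Lc M' (n + 1))) × Fin (d + 1) => ((b.1, Sum.inl b.2) : Idx (towerTorus Lc M' (n + 1)) (Fib d))) = H₀)
    (hQN : (perF (towerTorus Lc M' (n + 1)) MhN).submatrix fN (fun b : ↥(pbox (towerTorus Lc M' (n + 1))) × Fin (d + 1) => ((b.1, Sum.inl b.2) : Idx (towerTorus Lc M' (n + 1)) (Fib d))) = 𝔔₀)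
    -- (S3-2) N — the one-shot jets NAMED as full-index torus matrices (an2's composite namings): parities + block bindings DISPLAYED
    (VN VN' WN : Matrix (Idx (towerTorus Lc M' (n + 1)) (Fib d)) (Idx (towerTorus Lc M' (n + 1)) (Fib d)) ℝ)
    (hVNm : ∀ a a' : κ, VN (fN a) (fN a') = 0)
    (hVNt : ∀ (b : (↥(pbox (towerTorus Lc M' (n + 1))) × Fin (d + 1))) (a : κ), VN (b.1, Sum.inl b.2) (fN a) = VN (fN a) (b.1, Sum.inl b.2))
    (hVN'm : ∀ a a' : κ, VN' (fN a) (fN a') = 0)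
    (hVN't : ∀ (b : (↥(pbox (towerTorus Lc M' (n + 1))) × Fin (d + 1))) (a : κ), VN' (b.1, Sum.inl b.2) (fN a) = VN' (fN a) (b.1, Sum.inl b.2))
    (hWNm : ∀ a a' : κ, WN (fN a) (fN a') = 0)
    (hWNt : ∀ (b : (↥(pbox (towerTorus Lc M' (n + 1))) × Fin (d + 1))) (a : κ), WN (b.1, Sum.inl b.2) (fN a) = -WN (fN a) (b.1, Sum.inl b.2))
    (hHN₁ : H'₁f (dv k) = VN.submatrix (fun b : (↥(pbox (towerTorus Lc M' (n + 1))) × Fin (d + 1)) => ((b.1, Sum.inl b.2) : Idx (towerTorus Lc M' (n + 1)) (Fib d))) (fun b : (↥(pbox (towerTorus Lc M' (n + 1))) × Fin (d + 1)) => ((b.1, Sum.inl b.2) : Idx (towerTorus Lc M' (n + 1)) (Fib d))))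
    (hQN₁ : 𝔔'₁f (dv k) = VN.submatrix fN (fun b : (↥(pbox (towerTorus Lc M' (n + 1))) × Fin (d + 1)) => ((b.1, Sum.inl b.2) : Idx (towerTorus Lc M' (n + 1)) (Fib d))))
    (hHN₁' : H'₁f (dv l) = VN'.submatrix (fun b : (↥(pbox (towerTorus Lc M' (n + 1))) × Fin (d + 1)) => ((b.1, Sum.inl b.2) : Idx (towerTorus Lc M' (n + 1)) (Fib d))) (fun b : (↥(pbox (towerTorus Lc M' (n + 1))) × Fin (d + 1)) => ((b.1, Sum.inl b.2) : Idx (towerTorus Lc M' (n + 1)) (Fib d))))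
    (hQN₁' : 𝔔'₁f (dv l) = VN'.submatrix fN (fun b : (↥(pbox (towerTorus Lc M' (n + 1))) × Fin (d + 1)) => ((b.1, Sum.inl b.2) : Idx (towerTorus Lc M' (n + 1)) (Fib d))))
    (hHN₂ : (1 / 2 : ℝ) • (H'₂f (dv k) (dv l) + H'₂f (dv l) (dv k)) = WN.submatrix (fun b : (↥(pbox (towerTorus Lc M' (n + 1))) × Fin (d + 1)) => ((b.1, Sum.inl b.2) : Idx (towerTorus Lc M' (n + 1)) (Fib d))) (fun b : (↥(pbox (towerTorus Lc M' (n + 1))) × Fin (d + 1)) => ((b.1, Sum.inl b.2) : Idx (towerTorus Lc M' (n + 1)) (Fib d))))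
    (hQN₂ : (1 / 2 : ℝ) • (𝔔'₂f (dv k) (dv l) + 𝔔'₂f (dv l) (dv k)) = WN.submatrix fN (fun b : (↥(pbox (towerTorus Lc M' (n + 1))) × Fin (d + 1)) => ((b.1, Sum.inl b.2) : Idx (towerTorus Lc M' (n + 1)) (Fib d))))
    -- (S3-1) F — the composite ONE-SHOT CHART `(A_F, 𝕄_F)` of the tower below (depth `n+1`) by its SEVEN LETTERS at scale `bigRatio Lc n`, root
    -- `bigRoot Lc (rs ∘ succ) n`, slots `fF`, and the TWO BLOCK IDENTIFICATIONS `hHF hQF` — DISPLAYED ((C1)); the four sockets `hXF hEAF hAEF hLF` of #41d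
    -- come from leaf-05 `PackedLegOneShotSockets.towerF_rightInverse ∕ towerF_rules ∕ towerF_leg` (the tower's spelling, `towerTorus_succ` is `rfl`)
    {AF MhF : MKer (d + 1) (Fib d)} (hAF : Spr AF) (hMhF : Spr MhF)
    (hAFt : ∀ t : Fin (d + 1) → ℤ, shiftK ((bigRatio Lc n : ℤ) • t) AF = AF) (hMhFt : ∀ t : Fin (d + 1) → ℤ, shiftK ((bigRatio Lc n : ℤ) • t) MhF = MhF)
    (hrelF : RelInv AF MhF (axEc (bigRoot Lc (fun k => rs (k + 1)) n) (bigRatio Lc n)))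
    (hmmF : ∀ (x y : Fin (d + 1) → ℤ) (κ' l' : Fin (d + 1)), MhF x y (Sum.inr κ') (Sum.inr l') = 0)
    (hantiF : ∀ (x y : Fin (d + 1) → ℤ) (κ' l' : Fin (d + 1)), MhF x y (Sum.inl κ') (Sum.inr l') = -MhF y x (Sum.inr l') (Sum.inl κ'))
    (fF : (↥(pbox M') × Fin (d + 1)) → Idx (towerTorus Lc M' (n + 1)) (Fib d)) (hfF : Function.Injective fF)
    (hmF : ∀ a : (↥(pbox M') × Fin (d + 1)), ∃ m : Fin (d + 1), (fF a).2 = Sum.inr m)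
    (hcF : ∀ (s : ↥(pbox (towerTorus Lc M' (n + 1)))) (m : Fin (d + 1)), ((s, Sum.inr m) : Idx (towerTorus Lc M' (n + 1)) (Fib d)) ∈ Set.range fF ↔ Torus.proj (bigRatio Lc n) (s : Site (d + 1)) = 0)
    (hHF : (perF (towerTorus Lc M' (n + 1)) MhF).submatrix (fun b : ↥(pbox (towerTorus Lc M' (n + 1))) × Fin (d + 1) => ((b.1, Sum.inl b.2) : Idx (towerTorus Lc M' (n + 1)) (Fib d))) (fun b : ↥(pbox (towerTorus Lc M' (n + 1))) × Fin (d + 1) => ((b.1, Sum.inl b.2) : Idx (towerTorus Lc M' (n + 1)) (Fib d))) = H₀)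
    (hQF : (perF (towerTorus Lc M' (n + 1)) MhF).submatrix fF (fun b : ↥(pbox (towerTorus Lc M' (n + 1))) × Fin (d + 1) => ((b.1, Sum.inl b.2) : Idx (towerTorus Lc M' (n + 1)) (Fib d))) = Q₁₀)
    -- (S3-2) F — the fine one-shot jets NAMED: parities + block bindings DISPLAYED
    (VF VF' WF : Matrix (Idx (towerTorus Lc M' (n + 1)) (Fib d)) (Idx (towerTorus Lc M' (n + 1)) (Fib d)) ℝ)
    (hVFm : ∀ a a' : (↥(pbox M') × Fin (d + 1)), VF (fF a) (fF a') = 0)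
    (hVFt : ∀ (b : (↥(pbox (towerTorus Lc M' (n + 1))) × Fin (d + 1))) (a : (↥(pbox M') × Fin (d + 1))), VF (b.1, Sum.inl b.2) (fF a) = VF (fF a) (b.1, Sum.inl b.2))
    (hVF'm : ∀ a a' : (↥(pbox M') × Fin (d + 1)), VF' (fF a) (fF a') = 0)
    (hVF't : ∀ (b : (↥(pbox (towerTorus Lc M' (n + 1))) × Fin (d + 1))) (a : (↥(pbox M') × Fin (d + 1))), VF' (b.1, Sum.inl b.2) (fF a) = VF' (fF a) (b.1, Sum.inl b.2))
    (hWFm : ∀ a a' : (↥(pbox M') × Fin (d + 1)), WF (fF a) (fF a') = 0)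
    (hWFt : ∀ (b : (↥(pbox (towerTorus Lc M' (n + 1))) × Fin (d + 1))) (a : (↥(pbox M') × Fin (d + 1))), WF (b.1, Sum.inl b.2) (fF a) = -WF (fF a) (b.1, Sum.inl b.2))
    (hHF₁ : H₁f (dv k) = VF.submatrix (fun b : (↥(pbox (towerTorus Lc M' (n + 1))) × Fin (d + 1)) => ((b.1, Sum.inl b.2) : Idx (towerTorus Lc M' (n + 1)) (Fib d))) (fun b : (↥(pbox (towerTorus Lc M' (n + 1))) × Fin (d + 1)) => ((b.1, Sum.inl b.2) : Idx (towerTorus Lc M' (n + 1)) (Fib d))))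
    (hQF₁ : Q₁₁f (dv k) = VF.submatrix fF (fun b : (↥(pbox (towerTorus Lc M' (n + 1))) × Fin (d + 1)) => ((b.1, Sum.inl b.2) : Idx (towerTorus Lc M' (n + 1)) (Fib d))))
    (hHF₁' : H₁f (dv l) = VF'.submatrix (fun b : (↥(pbox (towerTorus Lc M' (n + 1))) × Fin (d + 1)) => ((b.1, Sum.inl b.2) : Idx (towerTorus Lc M' (n + 1)) (Fib d))) (fun b : (↥(pbox (towerTorus Lc M' (n + 1))) × Fin (d + 1)) => ((b.1, Sum.inl b.2) : Idx (towerTorus Lc M' (n + 1)) (Fib d))))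
    (hQF₁' : Q₁₁f (dv l) = VF'.submatrix fF (fun b : (↥(pbox (towerTorus Lc M' (n + 1))) × Fin (d + 1)) => ((b.1, Sum.inl b.2) : Idx (towerTorus Lc M' (n + 1)) (Fib d))))
    (hHF₂ : (1 / 2 : ℝ) • (H₂f (dv k) (dv l) + H₂f (dv l) (dv k)) = WF.submatrix (fun b : (↥(pbox (towerTorus Lc M' (n + 1))) × Fin (d + 1)) => ((b.1, Sum.inl b.2) : Idx (towerTorus Lc M' (n + 1)) (Fib d))) (fun b : (↥(pbox (towerTorus Lc M' (n + 1))) × Fin (d + 1)) => ((b.1, Sum.inl b.2) : Idx (towerTorus Lc M' (n + 1)) (Fib d))))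
    (hQF₂ : (1 / 2 : ℝ) • (Q₁₂f (dv k) (dv l) + Q₁₂f (dv l) (dv k)) = WF.submatrix fF (fun b : (↥(pbox (towerTorus Lc M' (n + 1))) × Fin (d + 1)) => ((b.1, Sum.inl b.2) : Idx (towerTorus Lc M' (n + 1)) (Fib d))))
    -- (S3-2) G — the top comb's jets NAMED, the H-blocks CARRYING THE UNIT `∏_{i<n+1} wVH d Lc (lev i)` of the composite's effective form (leaf-06
    -- `torus_kkt_nondeg_tower` .2.2: `S₁₁ = (∏ (wVH …)⁻¹) • 𝓗(M′, lev 0)|ff`; #40a moves it from the leg onto the blocks): parities + block bindings DISPLAYED;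
    -- the LEG is DISCHARGED inside (#41b `packedLeg_combAt_eq ∕ kkt_mul_inv_combAt` at `(rs 0, lev 0)`, chart kernel `A_G := Π̂ᵀ(KInvStep Lc (lev 0))Π̂` rooted at `rs 0`)
    (VG VG' WG : Matrix (Idx (M') (Fib d)) (Idx (M') (Fib d)) ℝ)
    (hVGm : ∀ a a' : κ, VG ((fun a : κ => ((pμ' a, Sum.inr (mμ' a)) : Idx M' (Fib d))) a) ((fun a : κ => ((pμ' a, Sum.inr (mμ' a)) : Idx M' (Fib d))) a') = 0)
    (hVGt : ∀ (b : (↥(pbox M') × Fin (d + 1))) (a : κ), VG (b.1, Sum.inl b.2) ((fun a : κ => ((pμ' a, Sum.inr (mμ' a)) : Idx M' (Fib d))) a) = VG ((fun a : κ => ((pμ' a, Sum.inr (mμ' a)) : Idx M' (Fib d))) a) (b.1, Sum.inl b.2))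
    (hVG'm : ∀ a a' : κ, VG' ((fun a : κ => ((pμ' a, Sum.inr (mμ' a)) : Idx M' (Fib d))) a) ((fun a : κ => ((pμ' a, Sum.inr (mμ' a)) : Idx M' (Fib d))) a') = 0)
    (hVG't : ∀ (b : (↥(pbox M') × Fin (d + 1))) (a : κ), VG' (b.1, Sum.inl b.2) ((fun a : κ => ((pμ' a, Sum.inr (mμ' a)) : Idx M' (Fib d))) a) = VG' ((fun a : κ => ((pμ' a, Sum.inr (mμ' a)) : Idx M' (Fib d))) a) (b.1, Sum.inl b.2))
    (hWGm : ∀ a a' : κ, WG ((fun a : κ => ((pμ' a, Sum.inr (mμ' a)) : Idx M' (Fib d))) a) ((fun a : κ => ((pμ' a, Sum.inr (mμ' a)) : Idx M' (Fib d))) a') = 0)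
    (hWGt : ∀ (b : (↥(pbox M') × Fin (d + 1))) (a : κ), WG (b.1, Sum.inl b.2) ((fun a : κ => ((pμ' a, Sum.inr (mμ' a)) : Idx M' (Fib d))) a) = -WG ((fun a : κ => ((pμ' a, Sum.inr (mμ' a)) : Idx M' (Fib d))) a) (b.1, Sum.inl b.2))
    (hHG₁ : (∏ i ∈ range (n + 1), wVH d Lc (lev i)) • Gw₁f (dv k) = VG.submatrix (fun b : (↥(pbox M') × Fin (d + 1)) => ((b.1, Sum.inl b.2) : Idx M' (Fib d))) (fun b : (↥(pbox M') × Fin (d + 1)) => ((b.1, Sum.inl b.2) : Idx M' (Fib d))))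
    (hQG₁ : Q₂₁f (dv k) = VG.submatrix (fun a : κ => ((pμ' a, Sum.inr (mμ' a)) : Idx M' (Fib d))) (fun b : (↥(pbox M') × Fin (d + 1)) => ((b.1, Sum.inl b.2) : Idx M' (Fib d))))
    (hHG₁' : (∏ i ∈ range (n + 1), wVH d Lc (lev i)) • Gw₁f (dv l) = VG'.submatrix (fun b : (↥(pbox M') × Fin (d + 1)) => ((b.1, Sum.inl b.2) : Idx M' (Fib d))) (fun b : (↥(pbox M') × Fin (d + 1)) => ((b.1, Sum.inl b.2) : Idx M' (Fib d))))
    (hQG₁' : Q₂₁f (dv l) = VG'.submatrix (fun a : κ => ((pμ' a, Sum.inr (mμ' a)) : Idx M' (Fib d))) (fun b : (↥(pbox M') × Fin (d + 1)) => ((b.1, Sum.inl b.2) : Idx M' (Fib d))))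
    (hHG₂ : (∏ i ∈ range (n + 1), wVH d Lc (lev i)) • ((1 / 2 : ℝ) • (Gw₂f (dv k) (dv l) + Gw₂f (dv l) (dv k))) = WG.submatrix (fun b : (↥(pbox M') × Fin (d + 1)) => ((b.1, Sum.inl b.2) : Idx M' (Fib d))) (fun b : (↥(pbox M') × Fin (d + 1)) => ((b.1, Sum.inl b.2) : Idx M' (Fib d))))
    (hQG₂ : (1 / 2 : ℝ) • (Q₂₂f (dv k) (dv l) + Q₂₂f (dv l) (dv k)) = WG.submatrix (fun a : κ => ((pμ' a, Sum.inr (mμ' a)) : Idx M' (Fib d))) (fun b : (↥(pbox M') × Fin (d + 1)) => ((b.1, Sum.inl b.2) : Idx M' (Fib d))))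
    : hessT (perF (towerTorus Lc M' (n + 1)) AN) VN VN' WN
      = hessT (perF (towerTorus Lc M' (n + 1)) AF) VF VF' WF + hessT (perF M' (coDressKBmAt (toSite (rs 0)) Lc (KInvStep (d := d) Lc (lev 0)))) VG VG' WG := by
  subst hτ₁
  exact hessT_fullIndex_law_tower M' Lc lev rs n (hrs := hrs) (hlev := hlev) (hM' := hM') (pμ' := pμ') (mμ' := mμ') (hfμ' := hfμ') (hcoarse' := hcoarse') (hH₀ := hH₀) (hQ₁₀ := hQ₁₀) (hτ₁ := rfl) (hτ₂ := hτ₂) (hQ₂₀ := hQ₂₀) (hW₀ := hW₀) (hP := rfl) (c := c) (hDbar := hDbar) (hΓ := hΓ) (hI := hI) (hL := hL) (hS := hS) (h𝔔₀ := h𝔔₀) (hv := hv) (lv := lv) (hlv := hlv) (Xbf := Xbf) (hXbf := hXbf) (H₁f := H₁f) (hH₁l := hH₁l) (Q₁₁f := Q₁₁f) (hQ₁₁l := hQ₁₁l) (Q₂₁f := Q₂₁f) (hQ₂₁l := hQ₂₁l) (H₂f := H₂f) (hH₂l := hH₂l) (hH₂r := hH₂r) (Q₁₂f := Q₁₂f)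 (hQ₁₂l := hQ₁₂l) (hQ₁₂r := hQ₁₂r) (Q₂₂f := Q₂₂f) (hQ₂₂l := hQ₂₂l) (hQ₂₂r := hQ₂₂r) (𝔔₁f := 𝔔₁f) (h𝔔₁ := h𝔔₁) (𝔔₂f := 𝔔₂f) (h𝔔₂ := h𝔔₂) (H'₁f := H'₁f) (hH'₁f := hH'₁f) (H'₂f := H'₂f) (hH'₂f := hH'₂f) (𝔔'₁f := 𝔔'₁f) (h𝔔'₁f := h𝔔'₁f) (𝔔'₂f := 𝔔'₂f) (h𝔔'₂f := h𝔔'₂f) (W₁f := W₁f) (W₂f := W₂f) (hW₁f := hW₁f) (hW₂f := hW₂f) (Db₁f := Db₁f) (Db₂f := Db₂f) (Y₁f := Y₁f) (Y₂f := Y₂f) (Gw₁f := Gw₁f) (hGw₁f := hGw₁f) (Gw₂f := Gw₂f) (hGw₂f := hGw₂f) (uTop := uTop) (hH₁t := hH₁t) (hH₂t := hH₂t) (a1 := a1) (a2 := a2) (c1 := c1) (c2 := c2) (d1 := d1) (d2 := d2) (dv := dv) (k := k) (l := l)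
    (hXN := towerN_rightInverse M' Lc rs (fun k => toSite_mem_range (hrs k)) n hM' hAN hMhN hANt hMhNt hrelN hmmN hantiN fN hfN hmN hcN hHN hQN)
    (ρN := bigRoot Lc rs (n + 1)) (LNc := bigRatio Lc (n + 1)) (fN := fN) (hfN := hfN) (hmN := hmN) (hcN := hcN)
    (hEAN := (towerN_rules M' Lc rs n hM' hAN hMhN hANt hMhNt hrelN).1) (hAEN := (towerN_rules M' Lc rs n hM' hAN hMhN hANt hMhNt hrelN).2)
    (hLN := towerN_leg M' Lc rs (fun k => toSite_mem_range (hrs k)) n hM' hAN hMhN hANt hMhNt hrelN hmmN hantiN fN hfN hmN hcN hHN hQN)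
    (VN := VN) (VN' := VN') (WN := WN) (hVNm := hVNm) (hVNt := hVNt) (hVN'm := hVN'm) (hVN't := hVN't) (hWNm := hWNm) (hWNt := hWNt)
    (hHN₁ := hHN₁) (hQN₁ := hQN₁) (hHN₁' := hHN₁') (hQN₁' := hQN₁') (hHN₂ := hHN₂) (hQN₂ := hQN₂)
    (hXF := towerF_rightInverse M' Lc rs (fun k => toSite_mem_range (hrs k)) n hAF hMhF hAFt hMhFt hrelF hmmF hantiF fF hfF hmF hcF hHF hQF)
    (ρF := bigRoot Lc (fun k => rs (k + 1)) n) (LFc := bigRatio Lc n) (fF := fF) (hfF := hfF) (hmF := hmF) (hcF := hcF)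
    (hEAF := (towerF_rules M' Lc rs n hAF hMhF hAFt hMhFt hrelF).1) (hAEF := (towerF_rules M' Lc rs n hAF hMhF hAFt hMhFt hrelF).2)
    (hLF := towerF_leg M' Lc rs (fun k => toSite_mem_range (hrs k)) n hAF hMhF hAFt hMhFt hrelF hmmF hantiF fF hfF hmF hcF hHF hQF)
    (VF := VF) (VF' := VF') (WF := WF) (hVFm := hVFm) (hVFt := hVFt) (hVF'm := hVF'm) (hVF't := hVF't) (hWFm := hWFm) (hWFt := hWFt)
    (hHF₁ := hHF₁) (hQF₁ := hQF₁) (hHF₁' := hHF₁') (hQF₁' := hQF₁') (hHF₂ := hHF₂) (hQF₂ := hQF₂)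
    (VG := VG) (VG' := VG') (WG := WG) (hVGm := hVGm) (hVGt := hVGt) (hVG'm := hVG'm) (hVG't := hVG't) (hWGm := hWGm) (hWGt := hWGt)
    (hHG₁ := hHG₁) (hQG₁ := hQG₁) (hHG₁' := hHG₁') (hQG₁' := hQG₁') (hHG₂ := hHG₂) (hQG₂ := hQG₂)

end Law

end Summit.QuantumFields.BalabanUV.Beta.FP.TowerLawFullIndexCharts

end
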